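import Summits.QuantumFields.BalabanUV.Beta.GAN24.ArrowOperator
import Summits.QuantumFields.BalabanUV.Beta.GAN24.ArrowNorms
import Summits.QuantumFields.BalabanUV.Beta.GAN24.ReadingWeightSums

/-!
# `BalabanUV.Beta.GAN24.ArrowScaling` — binder row G-an2-4 / (CONV-C), road P1-fibre, row **P1-L10** `FibreStrip` ((I3′)), cut «(M4) scaled alias-space
# Neumann, two anchors» = SKELETON-P1 A5 v0.3 (`HOME/b2b-balaban-gan24-formalise-leaf-16/L10-CUT-M4.md`), module **F1c**: THE SCALINGS —
# generic per-(alias, slot) scaling of arrow data (`= D_ρ · arrowMat · D_σ`), the INNER/OUTER radii, the scaled alias data whose blocks are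
# the KKT blocks of the NORMALISED symbols, invertibility transfer to (U1), and the UNIT KKT BLOCK at a real anchor

NOT IN PRINT; OUR PROOF ATTEMPT (of the road; THIS file is [folklore] bookkeeping: definitions, a diagonal-scaling identity, positivity of radii).
HONEST FRAMING (cell contract, verbatim): «discharging `BetaPertH` makes Bałaban's UV stability UNCONDITIONAL — a real constructive-QFT result;
it is NOT the continuum limit and NOT the Clay problem.»  HONEST DEPENDENCY (verbatim): «continuum YM on T⁴ ⇐ BetaPertH ∧ nine spine estimates
(0/9 proved); BetaPertH ⇐ (D1) ∧ (D4) ∧ CAP+tail; G-an2-4 gates asym, D1 and NE2/3/4.»  No cited fact, no wall binder, no `def … : Prop` hypothesis,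
no estimate; nothing of the K-slot of (CONV-C) is discharged here.  NOT summit progress.

## Contents
§1 `ArrowData.scale ρl ρb σl σb` and **`arrowMat_scale`**: `arrowMat (X.scale …) = diagonal (rowVec ρl ρb) * arrowMat X * diagonal (colVec σl σb)`;
   `isUnit_arrowMat_scale_iff` (nonzero weights); the bridge `arrowMat_eq_norms` with `ArrowNorms.colBorder/rowBorder` (`rfl`).
§2 THE CUT'S WEIGHTS (§1 of the cut): rows EL(m)×N²/r_m², G(m)×N³/r_m³, Q×N^{−(D+1)}, M×r₀/N^{D+1}; columns A×1, μ(m)×N/r_m, φ×r₀²/N³, c×r₀³/N³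
   (`rowLoc/rowBor/colLoc/colBor`); radii **`radO N q m := N·√(lapR (kfine N q m))`** (OUTER, anchor `q ∈ [−π,π]^D ∖ {0}`, all `m`) and
   **`radI N m := if m = 0 then 1 else N·√(lapR (kfine N 0 m))`** (INNER); `radI_pos`, `radO_pos`, `sq_radO`, `sq_radI`.
§3 **`scaledArrow N r r₀ p := (aliasArrow N p).scale …`**, `innerArrow N p`, `outerArrow N q p`; **`scaledArrow_T`**: the scaled block IS
   `tBlock ((N/r_m)•∂̂) ((N/r_m)•∂̂♭) ((N/r_m)²·L)` (KKT block of the NORMALISED symbols); `scaledArrow_wE/_wG/_wM/_wQ`;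
   `det_ne_zero_of_isUnit_scaledArrow` ⇒ `…_innerArrow`, `…_outerArrow` ((U1) from invertibility of the SCALED matrix).
§4 THE UNIT KKT BLOCK `uBlock d := tBlock d (star d) 1` and **`scaledArrow_T_ofRealVec`**: at a REAL momentum `q` with `r_m = radO N q m > 0` the scaled
   block is `uBlock (unitSym N q m)` with `Σ_κ ‖unitSym … κ‖² = 1`; at the inner anchor `p = 0`: `innerArrow_T_zero_of_ne` (m ≠ 0: `uBlock`),
   `innerArrow_T_zero_zero` (m = 0: the ZERO block).  (`uBlock d = ArrowUnitBlock.unitKKT d` entrywise, whose inverse has norm ≤ 5/2 — module F1d,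
   p202978; the one-line bridge rides with the first consumer.)
-/

noncomputable section

open Matrix WithLp Complex Finset
open scoped Matrix.Norms.L2Operator InnerProductSpace BigOperators ComplexConjugate Real
open Literature.MathematicalPhysics.QuantumFieldTheory.Balaban1983to89
open Literature.MathematicalPhysics.QuantumFieldTheory.Balaban1983to89.Beta
open Literature.Probability.LatticeModels (TorusSite)
open B4Strip (ofRealVec)
open BlochFibreMatrix (stencil pieceMatrix)
open FibreInverseDecay (trigPolySymbol)
open Summit.QuantumFields.BalabanUV.Beta.GAN24.FibreSymbols (dhat dflat lapSym)
open Summit.QuantumFields.BalabanUV.Beta.GAN24.FibreDFT (kFine)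
open Summit.QuantumFields.BalabanUV.Beta.GAN24.FibreArrow (chiHat sflat boxS boxSs)
open Summit.QuantumFields.BalabanUV.Beta.GAN24.AliasWeights (kfine)
open Summit.QuantumFields.BalabanUV.Beta.GAN24.AliasWeightsSum (lapR lapR_nonneg lapSym_ofReal four_le_sq_mul_lapR)
open Summit.QuantumFields.BalabanUV.Beta.GAN24.ReadingWeightSums (kFine_ofRealVec)
open Summit.QuantumFields.BalabanUV.Beta.GAN24.ArrowOperator
open Summit.QuantumFields.BalabanUV.Beta.GAN24.ArrowNorms (colBorder rowBorder)

namespace Summit.QuantumFields.BalabanUV.Beta.GAN24.ArrowScaling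

variable {D : ℕ} {ι : Type*} [Fintype ι] [DecidableEq ι]

/-! ## §1 Generic scaling of arrow data -/

/-- [folklore] SCALED ARROW DATA: local rows × `ρl m s`, border rows × `ρb s`, local columns × `σl m s`, border columns × `σb s`. -/
def _root_.Summit.QuantumFields.BalabanUV.Beta.GAN24.ArrowOperator.ArrowData.scale (X : ArrowData D ι) (ρl : ι → Loc D → ℝ) (ρb : Loc D → ℝ)
    (σl : ι → Loc D → ℝ) (σb : Loc D → ℝ) : ArrowData D ι :=
  ⟨fun m => diagonal (fun s => (ρl m s : ℂ)) * X.T m * diagonal (fun s => (σl m s : ℂ)),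
   fun m κ => ρl m (Sum.inl κ) * X.wE m κ * σb (Sum.inl κ), fun m => ρl m (Sum.inr ()) * X.wG m * σb (Sum.inr ()),
   fun m => ρb (Sum.inr ()) * X.wM m * σl m (Sum.inr ()), fun m κ => ρb (Sum.inl κ) * X.wQ m κ * σl m (Sum.inl κ)⟩

/-- [folklore] The row weights as one vector on `AIdx`. -/
def rowVec (ρl : ι → Loc D → ℝ) (ρb : Loc D → ℝ) : AIdx D ι → ℂ := Sum.elim (fun i => (ρl i.2 i.1 : ℂ)) fun s => (ρb s : ℂ)

/-- [folklore] The column weights as one vector on `AIdx`. -/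
def colVec (σl : ι → Loc D → ℝ) (σb : Loc D → ℝ) : AIdx D ι → ℂ := Sum.elim (fun i => (σl i.2 i.1 : ℂ)) fun s => (σb s : ℂ)

/-- [folklore] **SCALING IS DIAGONAL CONJUGATION**: `arrowMat (X.scale ρl ρb σl σb) = diagonal (rowVec ρl ρb) * arrowMat X * diagonal (colVec σl σb)`. -/
theorem arrowMat_scale (X : ArrowData D ι) (ρl : ι → Loc D → ℝ) (ρb : Loc D → ℝ) (σl : ι → Loc D → ℝ) (σb : Loc D → ℝ) :
    arrowMat (X.scale ρl ρb σl σb) = diagonal (rowVec ρl ρb) * arrowMat X * diagonal (colVec σl σb) := by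
  ext i j
  rw [mul_diagonal, diagonal_mul]
  rcases i with ⟨s, m⟩ | s <;> rcases j with ⟨s', m'⟩ | s'
  · simp only [arrowMat, fromBlocks_apply₁₁, blockDiagonal_apply', ArrowData.scale, rowVec, colVec, Sum.elim_inl]
    split_ifs with h
    · subst h; rw [mul_diagonal, diagonal_mul]
    · simp
  · simp only [arrowMat, fromBlocks_apply₁₂, borU, negLocW, ArrowData.locW, of_apply, ArrowData.scale, rowVec, colVec, Sum.elim_inl, Sum.elim_inr]
    split_ifs with h
    · subst h; cases s <;> simp
    · simp
  · simp only [arrowMat, fromBlocks_apply₂₁, borV, ArrowData.borW, of_apply, ArrowData.scale, rowVec, colVec, Sum.elim_inl, Sum.elim_inr]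
    split_ifs with h
    · subst h; cases s <;> simp
    · simp
  · simp [arrowMat, fromBlocks_apply₂₂]

omit [Fintype ι] in
/-- [folklore] The bridge with `ArrowNorms`: `arrowMat X = fromBlocks (blockDiagonal X.T) (colBorder (negLocW X)) (rowBorder X.borW) 0` (by `rfl`), so
`ArrowNorms.norm_arrow_le / isUnit_bordered / perturb / norm_colBorder_le / norm_rowBorder_le` apply to arrow matrices verbatim. -/
theorem arrowMat_eq_norms (X : ArrowData D ι) :
    arrowMat X = fromBlocks (blockDiagonal X.T) (colBorder (negLocW X)) (rowBorder X.borW) 0 := rfl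

/-- [folklore] A diagonal complex matrix with nonzero entries is invertible. -/
theorem isUnit_diagonal_of_ne_zero {n : Type*} [Fintype n] [DecidableEq n] {v : n → ℂ} (hv : ∀ i, v i ≠ 0) : IsUnit (diagonal v) :=
  (isUnit_iff_isUnit_det _).2 (by rw [det_diagonal]; exact isUnit_iff_ne_zero.2 (Finset.prod_ne_zero_iff.2 fun i _ => hv i))

/-- [folklore] **INVERTIBILITY TRANSFER**: with nonzero weights, the scaled arrow matrix is invertible iff the unscaled one is. -/
theorem isUnit_arrowMat_scale_iff (X : ArrowData D ι) {ρl : ι → Loc D → ℝ} {ρb : Loc D → ℝ} {σl : ι → Loc D → ℝ} {σb : Loc D → ℝ}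
    (hρ : ∀ i, rowVec ρl ρb i ≠ 0) (hσ : ∀ i, colVec σl σb i ≠ 0) :
    IsUnit (arrowMat (X.scale ρl ρb σl σb)) ↔ IsUnit (arrowMat X) := by
  rw [arrowMat_scale, isUnit_iff_isUnit_det, isUnit_iff_isUnit_det (arrowMat X), det_mul, det_mul, IsUnit.mul_iff, IsUnit.mul_iff]
  have h1 : IsUnit (diagonal (rowVec ρl ρb)).det := (isUnit_iff_isUnit_det _).1 (isUnit_diagonal_of_ne_zero hρ)
  have h2 : IsUnit (diagonal (colVec σl σb)).det := (isUnit_iff_isUnit_det _).1 (isUnit_diagonal_of_ne_zero hσ)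
  exact ⟨fun h => h.1.2, fun h => ⟨⟨h1, h⟩, h2⟩⟩

/-! ## §2 The cut's weights and radii -/

section Weights

variable {N : ℕ} [NeZero N]

/-- [folklore] LOCAL ROW weights: EL rows × `N²/r_m²`, G row × `N³/r_m³`. -/
def rowLoc (N : ℕ) (r : ι → ℝ) (m : ι) : Loc D → ℝ := Sum.elim (fun _ => (N : ℝ) ^ 2 / r m ^ 2) fun _ => (N : ℝ) ^ 3 / r m ^ 3

/-- [folklore] LOCAL COLUMN weights: A columns × `1`, μ column × `N/r_m`. -/
def colLoc (N : ℕ) (r : ι → ℝ) (m : ι) : Loc D → ℝ := Sum.elim (fun _ => 1) fun _ => (N : ℝ) / r m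

/-- [folklore] BORDER ROW weights: Q rows × `N^{−(D+1)}`, M row × `r₀/N^{D+1}`. -/
def rowBor (D N : ℕ) (r0 : ℝ) : Loc D → ℝ := Sum.elim (fun _ => ((N : ℝ) ^ (D + 1))⁻¹) fun _ => r0 / (N : ℝ) ^ (D + 1)

/-- [folklore] BORDER COLUMN weights: φ columns × `r₀²/N³`, c column × `r₀³/N³`. -/
def colBor (N : ℕ) (r0 : ℝ) : Loc D → ℝ := Sum.elim (fun _ => r0 ^ 2 / (N : ℝ) ^ 3) fun _ => r0 ^ 3 / (N : ℝ) ^ 3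

/-- [folklore] **OUTER RADIUS** (anchor a real momentum `q`): `r_m = N·√(lapR (kfine N q m))` — the square root of the block's own scaled Laplacian symbol,
for EVERY alias including `m = 0` (`≍ |q + 2π·fold m|`). -/
def radO (N : ℕ) (q : Fin D → ℝ) (m : TorusSite D N) : ℝ := (N : ℝ) * Real.sqrt (lapR (kfine N q m))

/-- [folklore] **INNER RADIUS** (anchor `p = 0`): `r_m = N·√(lapR (kfine N 0 m))` for `m ≠ 0`, and `r_0 = 1` for the zero alias. -/
def radI (N : ℕ) [NeZero N] (m : TorusSite D N) : ℝ := if m = 0 then 1 else (N : ℝ) * Real.sqrt (lapR (kfine N 0 m))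

omit [NeZero N] in
/-- [folklore] `radO² = N²·lapR`. -/
theorem sq_radO (q : Fin D → ℝ) (m : TorusSite D N) : radO N q m ^ 2 = (N : ℝ) ^ 2 * lapR (kfine N q m) := by
  rw [radO, mul_pow, Real.sq_sqrt (lapR_nonneg _)]

/-- [folklore] `radI² = N²·lapR` off the zero alias. -/
theorem sq_radI {m : TorusSite D N} (hm : m ≠ 0) : radI N m ^ 2 = (N : ℝ) ^ 2 * lapR (kfine N 0 m) := by
  rw [radI, if_neg hm, mul_pow, Real.sq_sqrt (lapR_nonneg _)]

/-- [folklore] The zero-alias real fine momentum is `q/N`; its scaled Laplacian symbol is positive for `q ∈ [−π,π]^D ∖ {0}` (Jordan). -/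
theorem lapR_kfine_zero_pos {q : Fin D → ℝ} (hq : ∀ i, |q i| ≤ π) (hq0 : q ≠ 0) : 0 < lapR (kfine N q 0) := by
  obtain ⟨i, hi⟩ : ∃ i, q i ≠ 0 := by
    by_contra h; exact hq0 (funext fun i => by simpa using (not_exists.1 h) i)
  have hN : (0 : ℝ) < N := by exact_mod_cast Nat.pos_of_ne_zero (NeZero.ne N)
  have hterm : ∀ j, 0 ≤ 4 * Real.sin (kfine N q 0 j / 2) ^ 2 := fun j => by positivity
  refine lt_of_lt_of_le ?_ (Finset.single_le_sum (fun j _ => hterm j) (Finset.mem_univ i))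
  have e : kfine N q 0 i / 2 = q i / (2 * N) := by simp [kfine]; ring
  rw [e]
  have hqi : |q i| ≤ π * N := (hq i).trans (le_mul_of_one_le_right Real.pi_pos.le (by exact_mod_cast Nat.one_le_iff_ne_zero.2 (NeZero.ne N)))
  have hj := SymbolTaylor.jordan_sq_mul_four_sin_sq hN hqi
  have hpos : 0 < 4 / π ^ 2 * q i ^ 2 := by have := Real.pi_pos; positivity
  nlinarith [sq_nonneg (N : ℝ)]

/-- [folklore] `radO N q m > 0` for `q ∈ [−π,π]^D ∖ {0}` (m ≠ 0: `4 ≤ N²·lapR`, `AliasWeightsSum.four_le_sq_mul_lapR`; m = 0: the previous lemma). -/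
theorem radO_pos {q : Fin D → ℝ} (hq : ∀ i, |q i| ≤ π) (hq0 : q ≠ 0) (m : TorusSite D N) : 0 < radO N q m := by
  have hN : (0 : ℝ) < N := by exact_mod_cast Nat.pos_of_ne_zero (NeZero.ne N)
  refine mul_pos hN (Real.sqrt_pos.2 ?_)
  by_cases hm : m = 0
  · subst hm; exact lapR_kfine_zero_pos hq hq0
  · have h4 := four_le_sq_mul_lapR (N := N) hq hm
    nlinarith [sq_nonneg (N : ℝ)]

/-- [folklore] `radI N m > 0` always. -/
theorem radI_pos (m : TorusSite D N) : 0 < radI N m := by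
  unfold radI
  split_ifs with hm
  · exact one_pos
  · have hN : (0 : ℝ) < N := by exact_mod_cast Nat.pos_of_ne_zero (NeZero.ne N)
    have h4 := four_le_sq_mul_lapR (N := N) (p := 0) (fun i => by simp [Real.pi_pos.le]) hm
    exact mul_pos hN (Real.sqrt_pos.2 (by nlinarith [sq_nonneg (N : ℝ)]))

end Weights

/-! ## §3 The scaled alias data -/

section Scaled

variable {N : ℕ} [NeZero N]

/-- [folklore] **THE SCALED ALIAS ARROW DATA** of the cut, radii `r`, border radius `r₀`, momentum `p` (complex). -/
def scaledArrow (N : ℕ) [NeZero N] (r : TorusSite D N → ℝ) (r0 : ℝ) (p : Fin D → ℂ) : ArrowData D (TorusSite D N) :=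
  (aliasArrow N p).scale (rowLoc N r) (rowBor D N r0) (colLoc N r) (colBor N r0)

/-- [folklore] INNER scaled data (anchor `p = 0`, `r₀ = 1`). -/
def innerArrow (N : ℕ) [NeZero N] (p : Fin D → ℂ) : ArrowData D (TorusSite D N) := scaledArrow N (radI N) 1 p

/-- [folklore] OUTER scaled data (anchor the real momentum `q`; evaluated at the complex momentum `p`, e.g. `p = ofRealVec q + iη·a`). -/
def outerArrow (N : ℕ) [NeZero N] (q : Fin D → ℝ) (p : Fin D → ℂ) : ArrowData D (TorusSite D N) := scaledArrow N (radO N q) (radO N q 0) p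

/-- [folklore] Diagonal conjugation of a KKT block is the KKT block of the rescaled symbols:
`diag(a·1, a·b) · tBlock dd db L · diag(1, c) = tBlock (c•dd) (c•db) (c²L)` when `a = c²`, `a·b = c³` — here with `c = N/r`. -/
theorem diagonal_tBlock_diagonal (dd db : Fin D → ℂ) (L c : ℂ) :
    diagonal (Sum.elim (fun _ : Fin D => c ^ 2) fun _ : Unit => c ^ 3) * tBlock dd db L * diagonal (Sum.elim (fun _ : Fin D => (1 : ℂ)) fun _ : Unit => c) =
      tBlock (fun κ => c * dd κ) (fun κ => c * db κ) (c ^ 2 * L) := by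
  ext i j
  rw [mul_diagonal, diagonal_mul]
  rcases i with κ | u <;> rcases j with l | u'
  · simp only [tBlock, of_apply, Sum.elim_inl]; split_ifs <;> ring
  · simp only [tBlock, of_apply, Sum.elim_inl, Sum.elim_inr]; ring
  · simp only [tBlock, of_apply, Sum.elim_inl, Sum.elim_inr]; ring
  · simp only [tBlock, of_apply, Sum.elim_inr]; ring

/-- [folklore] **THE SCALED BLOCK IS THE KKT BLOCK OF THE NORMALISED SYMBOLS** `(N/r_m)•∂̂(k_m)`, `(N/r_m)•∂̂♭(k_m)`, `(N/r_m)²·L(k_m)`. -/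
theorem scaledArrow_T (r : TorusSite D N → ℝ) (r0 : ℝ) (p : Fin D → ℂ) (m : TorusSite D N) :
    (scaledArrow N r r0 p).T m =
      tBlock (fun κ => ((N : ℝ) / r m : ℂ) * dhat (kFine p m) κ) (fun κ => ((N : ℝ) / r m : ℂ) * dflat (kFine p m) κ)
        (((N : ℝ) / r m : ℂ) ^ 2 * lapSym (kFine p m)) := by
  have hρ : (fun s => ((rowLoc N r m s : ℝ) : ℂ)) = Sum.elim (fun _ : Fin D => ((N : ℝ) / r m : ℂ) ^ 2) fun _ : Unit => ((N : ℝ) / r m : ℂ) ^ 3 := by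
    funext s; cases s <;> simp [rowLoc, div_pow]
  have hσ : (fun s => ((colLoc N r m s : ℝ) : ℂ)) = Sum.elim (fun _ : Fin D => (1 : ℂ)) fun _ : Unit => ((N : ℝ) / r m : ℂ) := by
    funext s; cases s <;> simp [colLoc]
  show diagonal (fun s => ((rowLoc N r m s : ℝ) : ℂ)) * (aliasArrow N p).T m * diagonal (fun s => ((colLoc N r m s : ℝ) : ℂ)) = _
  rw [hρ, hσ, aliasArrow_T, diagonal_tBlock_diagonal]

/-- [folklore] Scaled EL-border weight: `(N²/r_m²)·χ̂ s♭_κ·(r₀²/N³)`. -/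
theorem scaledArrow_wE (r : TorusSite D N → ℝ) (r0 : ℝ) (p : Fin D → ℂ) (m : TorusSite D N) (κ : Fin D) :
    (scaledArrow N r r0 p).wE m κ = ((N : ℝ) ^ 2 / r m ^ 2 : ℝ) * (chiHat p m * sflat p m κ) * (r0 ^ 2 / (N : ℝ) ^ 3 : ℝ) := rfl

/-- [folklore] Scaled G-border weight: `(N³/r_m³)·χ̂·(r₀³/N³)`. -/
theorem scaledArrow_wG (r : TorusSite D N → ℝ) (r0 : ℝ) (p : Fin D → ℂ) (m : TorusSite D N) :
    (scaledArrow N r r0 p).wG m = ((N : ℝ) ^ 3 / r m ^ 3 : ℝ) * chiHat p m * (r0 ^ 3 / (N : ℝ) ^ 3 : ℝ) := rfl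

/-- [folklore] Scaled M-row weight: `(r₀/N^{D+1})·S·(N/r_m)`. -/
theorem scaledArrow_wM (r : TorusSite D N → ℝ) (r0 : ℝ) (p : Fin D → ℂ) (m : TorusSite D N) :
    (scaledArrow N r r0 p).wM m = (r0 / (N : ℝ) ^ (D + 1) : ℝ) * boxS p m * ((N : ℝ) / r m : ℝ) := rfl

/-- [folklore] Scaled Q-row weight: `N^{−(D+1)}·S s_κ`. -/
theorem scaledArrow_wQ (r : TorusSite D N → ℝ) (r0 : ℝ) (p : Fin D → ℂ) (m : TorusSite D N) (κ : Fin D) :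
    (scaledArrow N r r0 p).wQ m κ = (((N : ℝ) ^ (D + 1))⁻¹ : ℝ) * boxSs p m κ * (1 : ℝ) := rfl

/-- [folklore] With positive radii and `N ≥ 1`, every weight of the cut is nonzero (rows). -/
theorem rowVec_ne_zero {r : TorusSite D N → ℝ} (hr : ∀ m, 0 < r m) {r0 : ℝ} (hr0 : 0 < r0) (i : AIdx D (TorusSite D N)) :
    rowVec (rowLoc N r) (rowBor D N r0) i ≠ 0 := by
  have hN : (0 : ℝ) < N := by exact_mod_cast Nat.pos_of_ne_zero (NeZero.ne N)
  rcases i with ⟨s, m⟩ | s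
  · cases s <;> simp only [rowVec, Sum.elim_inl, rowLoc, Sum.elim_inr, ne_eq, Complex.ofReal_eq_zero] <;> exact (by have := hr m; positivity)
  · cases s <;> simp only [rowVec, Sum.elim_inr, rowBor, Sum.elim_inl, ne_eq, Complex.ofReal_eq_zero] <;> exact (by positivity)

/-- [folklore] … and (columns). -/
theorem colVec_ne_zero {r : TorusSite D N → ℝ} (hr : ∀ m, 0 < r m) {r0 : ℝ} (hr0 : 0 < r0) (i : AIdx D (TorusSite D N)) :
    colVec (colLoc N r) (colBor N r0) i ≠ 0 := by
  have hN : (0 : ℝ) < N := by exact_mod_cast Nat.pos_of_ne_zero (NeZero.ne N)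
  rcases i with ⟨s, m⟩ | s
  · cases s <;> simp only [colVec, Sum.elim_inl, colLoc, Sum.elim_inr, ne_eq, Complex.ofReal_eq_zero] <;> [exact one_ne_zero; exact (by have := hr m; positivity)]
  · cases s <;> simp only [colVec, Sum.elim_inr, colBor, Sum.elim_inl, ne_eq, Complex.ofReal_eq_zero] <;> exact (by positivity)

/-- [folklore] **(U1) FROM THE SCALED MATRIX**: for positive radii, `IsUnit (arrowMat (scaledArrow N r r₀ p))` gives `det (trigPolySymbol (stencil (d+1)) pieceMatrix p) ≠ 0`. -/
theorem det_ne_zero_of_isUnit_scaledArrow {d : ℕ} {N : ℕ} [NeZero N] {r : TorusSite (d + 1) N → ℝ} (hr : ∀ m, 0 < r m) {r0 : ℝ} (hr0 : 0 < r0)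
    (p : Fin (d + 1) → ℂ) (h : IsUnit (arrowMat (scaledArrow N r r0 p))) :
    (trigPolySymbol (stencil (d + 1)) (pieceMatrix (N := N)) p).det ≠ 0 :=
  det_trigPolySymbol_ne_zero_of_isUnit p ((isUnit_arrowMat_scale_iff _ (rowVec_ne_zero hr hr0) (colVec_ne_zero hr hr0)).1 h)

/-- [folklore] (U1) from the INNER-scaled matrix (every complex `p`). -/
theorem det_ne_zero_of_isUnit_innerArrow {d : ℕ} {N : ℕ} [NeZero N] (p : Fin (d + 1) → ℂ) (h : IsUnit (arrowMat (innerArrow N p))) :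
    (trigPolySymbol (stencil (d + 1)) (pieceMatrix (N := N)) p).det ≠ 0 :=
  det_ne_zero_of_isUnit_scaledArrow radI_pos one_pos p h

/-- [folklore] (U1) from the OUTER-scaled matrix (anchor `q ∈ [−π,π]^{d+1} ∖ {0}`, any complex `p`). -/
theorem det_ne_zero_of_isUnit_outerArrow {d : ℕ} {N : ℕ} [NeZero N] {q : Fin (d + 1) → ℝ} (hq : ∀ i, |q i| ≤ π) (hq0 : q ≠ 0)
    (p : Fin (d + 1) → ℂ) (h : IsUnit (arrowMat (outerArrow N q p))) :
    (trigPolySymbol (stencil (d + 1)) (pieceMatrix (N := N)) p).det ≠ 0 :=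
  det_ne_zero_of_isUnit_scaledArrow (radO_pos hq hq0) (radO_pos hq hq0 0) p h

end Scaled

/-! ## §4 The unit KKT block at a real anchor -/

section Unit

variable {N : ℕ} [NeZero N]

/-- [folklore] THE UNIT KKT BLOCK of a vector `d` (used with `Σ_κ ‖d κ‖² = 1`): `tBlock d (star d) 1 = [[2(1 − d dᴴ), −d],[dᴴ, 0]]`. -/
def uBlock (d : Fin D → ℂ) : Matrix (Loc D) (Loc D) ℂ := tBlock d (star d) 1

/-- [folklore] THE NORMALISED DIFFERENCE SYMBOL at a real momentum: `(N/r_m)·∂̂(kfine N q m)`, `r_m = radO N q m` (a REAL scalar times the symbol). -/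
def unitSym (N : ℕ) [NeZero N] (q : Fin D → ℝ) (m : TorusSite D N) (κ : Fin D) : ℂ :=
  (((N : ℝ) / radO N q m : ℝ) : ℂ) * dhat (ofRealVec (kfine N q m)) κ

omit [NeZero N] in
/-- [folklore] `kFine (ofRealVec q) m = ofRealVec (kfine N q m)` (leaf-01's dictionary, as a function). -/
theorem kFine_ofRealVec_eq (q : Fin D → ℝ) (m : TorusSite D N) : kFine (ofRealVec q) m = ofRealVec (kfine N q m) := by
  funext i; rw [kFine_ofRealVec]; rfl

omit [NeZero N] in
/-- [folklore] At real fine momentum `∂̂♭ = conj ∂̂`. -/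
theorem dflat_ofRealVec_eq_conj (k : Fin D → ℝ) (κ : Fin D) : dflat (ofRealVec k) κ = conj (dhat (ofRealVec k) κ) :=
  FibreGaffney.dflat_eq_conj_dhat (fun κ => by show conj ((k κ : ℝ) : ℂ) = (k κ : ℂ); exact Complex.conj_ofReal _) κ

omit [NeZero N] in
/-- [folklore] `lapSym (ofRealVec k) = lapR k` (cast). -/
theorem lapSym_ofRealVec_eq (k : Fin D → ℝ) : lapSym (ofRealVec k) = ((lapR k : ℝ) : ℂ) := lapSym_ofReal k

omit [NeZero N] in
/-- [folklore] `Σ_κ ‖∂̂(k) κ‖² = lapR k` at a real fine momentum. -/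
theorem sum_norm_sq_dhat_ofRealVec (k : Fin D → ℝ) : ∑ κ, ‖dhat (ofRealVec k) κ‖ ^ 2 = lapR k := by
  unfold lapR
  refine Finset.sum_congr rfl fun κ _ => ?_
  rw [SymbolTaylor.norm_dhat_ofRealVec, mul_pow, sq_abs]; norm_num

omit [NeZero N] in
/-- [folklore] The real normalisation: `(N/r_m)²·lapR = 1` when `r_m = radO N q m > 0`. -/
theorem sq_div_radO_mul_lapR {q : Fin D → ℝ} {m : TorusSite D N} (hr : 0 < radO N q m) :
    ((N : ℝ) / radO N q m) ^ 2 * lapR (kfine N q m) = 1 := by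
  rw [div_pow, div_mul_eq_mul_div, ← sq_radO, div_self (pow_ne_zero 2 hr.ne')]

/-- [folklore] **UNIT NORMALISATION**: `Σ_κ ‖unitSym N q m κ‖² = 1` whenever `radO N q m > 0`. -/
theorem sum_norm_sq_unitSym {q : Fin D → ℝ} {m : TorusSite D N} (hr : 0 < radO N q m) : ∑ κ, ‖unitSym N q m κ‖ ^ 2 = 1 := by
  have hc : ∀ κ, ‖unitSym N q m κ‖ ^ 2 = ((N : ℝ) / radO N q m) ^ 2 * ‖dhat (ofRealVec (kfine N q m)) κ‖ ^ 2 := fun κ => by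
    rw [unitSym, norm_mul, mul_pow, Complex.norm_real, Real.norm_eq_abs, sq_abs]
  simp only [hc, ← Finset.mul_sum, sum_norm_sq_dhat_ofRealVec, sq_div_radO_mul_lapR hr]

/-- [folklore] **THE SCALED BLOCK AT A REAL MOMENTUM IS A UNIT KKT BLOCK**: with `r = radO N q` (all radii positive),
`(scaledArrow N (radO N q) r₀ (ofRealVec q)).T m = uBlock (unitSym N q m)`. -/
theorem scaledArrow_T_ofRealVec {q : Fin D → ℝ} (hr : ∀ m, 0 < radO N q m) (r0 : ℝ) (m : TorusSite D N) :
    (scaledArrow N (radO N q) r0 (ofRealVec q)).T m = uBlock (unitSym N q m) := by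
  rw [scaledArrow_T, uBlock, kFine_ofRealVec_eq]
  simp only [← Complex.ofReal_div]
  have hdd : (fun κ => (((N : ℝ) / radO N q m : ℝ) : ℂ) * dhat (ofRealVec (kfine N q m)) κ) = unitSym N q m := rfl
  have hdb : (fun κ => (((N : ℝ) / radO N q m : ℝ) : ℂ) * dflat (ofRealVec (kfine N q m)) κ) = star (unitSym N q m) := by
    funext κ
    rw [Pi.star_apply, unitSym, star_mul', Complex.star_def, Complex.conj_ofReal, dflat_ofRealVec_eq_conj]
  have hL : (((N : ℝ) / radO N q m : ℝ) : ℂ) ^ 2 * lapSym (ofRealVec (kfine N q m)) = 1 := by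
    rw [lapSym_ofRealVec_eq, ← Complex.ofReal_pow, ← Complex.ofReal_mul, sq_div_radO_mul_lapR (hr m), Complex.ofReal_one]
  rw [hdd, hdb, hL]

/-! ### The inner anchor `p = 0`: unit blocks off the zero alias, the ZERO block at the zero alias -/

/-- [folklore] Off the zero alias the inner radius is the outer radius anchored at `q = 0`. -/
theorem radI_of_ne {m : TorusSite D N} (hm : m ≠ 0) : radI N m = radO N 0 m := by rw [radI, if_neg hm, radO]

/-- [folklore] `radO N 0 m > 0` off the zero alias. -/
theorem radO_zero_pos_of_ne {m : TorusSite D N} (hm : m ≠ 0) : 0 < radO N (0 : Fin D → ℝ) m := by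
  rw [← radI_of_ne hm]; exact radI_pos m

omit [NeZero N] in
/-- [folklore] `ofRealVec 0 = 0`. -/
theorem ofRealVec_zero : ofRealVec (0 : Fin D → ℝ) = (0 : Fin D → ℂ) := by funext i; simp [ofRealVec]

/-- [folklore] `tBlock` of zero symbols is the zero matrix. -/
theorem tBlock_zero : tBlock (D := D) 0 0 0 = 0 := by
  ext i j; rcases i with κ | u <;> rcases j with l | u' <;> simp [tBlock]

/-- [folklore] **INNER ANCHOR, m ≠ 0**: `(innerArrow N 0).T m = uBlock (unitSym N 0 m)` — a unit KKT block (`Σ‖unitSym‖² = 1` by `sum_norm_sq_unitSym (radO_zero_pos_of_ne hm)`). -/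
theorem innerArrow_T_zero_of_ne {m : TorusSite D N} (hm : m ≠ 0) : (innerArrow N (0 : Fin D → ℂ)).T m = uBlock (unitSym N 0 m) := by
  rw [innerArrow, scaledArrow_T, uBlock, ← ofRealVec_zero, kFine_ofRealVec_eq, radI_of_ne hm]
  simp only [← Complex.ofReal_div]
  have hdb : (fun κ => (((N : ℝ) / radO N 0 m : ℝ) : ℂ) * dflat (ofRealVec (kfine N 0 m)) κ) = star (unitSym N 0 m) := by
    funext κ
    rw [Pi.star_apply, unitSym, star_mul', Complex.star_def, Complex.conj_ofReal, dflat_ofRealVec_eq_conj]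
  have hL : (((N : ℝ) / radO N 0 m : ℝ) : ℂ) ^ 2 * lapSym (ofRealVec (kfine N 0 m)) = 1 := by
    rw [lapSym_ofRealVec_eq, ← Complex.ofReal_pow, ← Complex.ofReal_mul, sq_div_radO_mul_lapR (radO_zero_pos_of_ne hm), Complex.ofReal_one]
  rw [hdb, hL]; rfl

/-- [folklore] **INNER ANCHOR, m = 0**: the zero-alias block of `innerArrow N 0` is the ZERO matrix (`∂̂(0) = 0`, `L(0) = 0`; the Q/M/EL₀/G₀ borders pin it). -/
theorem innerArrow_T_zero_zero : (innerArrow N (0 : Fin D → ℂ)).T 0 = 0 := by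
  rw [innerArrow, scaledArrow_T]
  have hk : kFine (0 : Fin D → ℂ) (0 : TorusSite D N) = 0 := by
    funext i; simp [kFine, BlochFibreMatrix.repZ_zero]
  have hd : dhat (0 : Fin D → ℂ) = 0 := by funext κ; simp [FibreSymbols.dhat]
  have hb : dflat (0 : Fin D → ℂ) = 0 := by funext κ; simp [FibreSymbols.dflat]
  have hL : lapSym (0 : Fin D → ℂ) = 0 := by simp [FibreSymbols.lapSym, hd]
  rw [hk, hd, hb, hL]
  simp only [Pi.zero_apply, mul_zero]
  exact tBlock_zero

end Unit

end Summit.QuantumFields.BalabanUV.Beta.GAN24.ArrowScaling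

end
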